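import Literature.Computability.MetaComplexity.DepthFregeGaussianEliminationRows
import HarnessLib

/-!
# Gaussian elimination inside bounded-depth Frege, II: the chain along a dual certificate

Fifth layer of the depth-dependent bounded-depth Frege upper bound for linear algebra over `𝔽₂`
(`DepthFregeGaussianElimination.lean`). For an UNSATISFIABLE system `E : Fin m → LinEqMod 2 n` with
`n ≤ a^D`, `F = ofCNF (sumEncoding 1 E)`, we derive `¬F` in `TextbookFrege.BD` at disjunct depth
`2D + 18`:

* `tset`, `tbit`, `chainHpS` — along a list of rows, the carried line
  `⊢ hp a (tset es) D 0 (tbit es), ¬F` (symmetric difference of the supports, sum of the right-hand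
  sides), each step two cuts against the row (`rowHpS`) and a root combination sequent (`combS`);
  the carried line is used once, so line counts add (`stepHLines`);
* `exists_certificate` — unsatisfiability gives a list of `≤ m` rows summing to `0 = 1`
  (`exists_lincomb_eq_zero_one`), i.e. `tset = ∅`, `tbit = true`;
* `refuteHpS` — `startS`, the chain at the certificate, `endS`: a bounded derivation of `¬F` with
  `totHLines` lines.

All statements are proved.

References: J. Håstad, J. ACM 68 (2021), §1; N. Galesi, D. Itsykson, A. Riazanov, A. Sofronova,
APAL 174 (2023), §4; P. Clote, E. Kranakis (2002), §5.5.3 (dual certificates over `𝔽₂`).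
-/

namespace Literature.Computability.MetaComplexity

open Complexity Complexity.PropForm TextbookFrege KrajicekRamsey Finset Complexity.Stockmeyer

namespace HierParity

variable {a : ℕ}

/-! ### The chain along a list of rows -/

section Chain

variable {m n : ℕ} (E : Fin m → LinEqMod 2 n)

/-- The symmetric difference of the supports of a list of rows. [folklore] -/
def tset : List (Fin m) → Finset ℕ
  | [] => ∅
  | e :: es => symmDiff (tset es) (rowSet E e)

/-- The sum of the right-hand sides of a list of rows, as a bit. [folklore] -/
def tbit : List (Fin m) → Bool
  | [] => false
  | e :: es => xor (tbit es) (rowBit E e)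

variable {E}

/-- Over `𝔽₂` the support of a sum is the symmetric difference of the supports. [folklore] -/
theorem supp_add_two (x y : LinEqMod 2 n) : (x + y).supp = symmDiff x.supp y.supp := by
  have h01 : ∀ b : ZMod 2, b = 0 ∨ b = 1 := by decide
  ext j
  simp only [LinEqMod.mem_supp, Finset.mem_symmDiff, Prod.fst_add, Pi.add_apply]
  rcases h01 (x.1 j) with hx | hx <;> rcases h01 (y.1 j) with hy | hy <;> simp [hx, hy]
  all_goals decide

/-- `tset` is the support of the sum of the rows. [folklore] -/
theorem tset_eq (es : List (Fin m)) : tset E es = ((es.map E).sum).supp.image Fin.val := by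
  induction es with
  | nil => simp [tset, LinEqMod.supp]
  | cons e es ih =>
    rw [tset, ih, List.map_cons, List.sum_cons, supp_add_two, image_symmDiff _ _ Fin.val_injective,
      rowSet, symmDiff_comm]

/-- `tbit` is the right-hand side of the sum of the rows. [folklore] -/
theorem bz_tbit (es : List (Fin m)) : bz (tbit E es) = ((es.map E).sum).2 := by
  induction es with
  | nil => simp [tbit]
  | cons e es ih =>
    rw [tbit, bz_xor, ih, bz_rowBit, List.map_cons, List.sum_cons, Prod.snd_add, add_comm]

/-- **The dual certificate**: an unsatisfiable system over `𝔽₂` has a list of at most `m` rows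
summing to the contradiction `0 = 1`, i.e. with empty accumulated support and accumulated bit `1`.
[Clote–Kranakis 2002, §5.5.3 (completeness of the Gaussian calculus)] [folklore] -/
theorem exists_certificate (hE : ¬ SystemSat E univ) :
    ∃ es : List (Fin m), es.length ≤ m ∧ tset E es = ∅ ∧ tbit E es = true := by
  have h01 : ∀ b : ZMod 2, b = 0 ∨ b = 1 := by decide
  haveI : Fact (Nat.Prime 2) := ⟨Nat.prime_two⟩
  obtain ⟨v, hv⟩ := exists_lincomb_eq_zero_one E hE
  set R := univ.filter fun e => v e = 1 with hR
  refine ⟨R.toList, ?_, ?_, ?_⟩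
  · rw [length_toList]; exact (card_filter_le _ _).trans (by simp)
  · have hsum : (R.toList.map E).sum = lincomb v E := by
      rw [sum_map_toList, lincomb_eq_sum, hR, sum_filter]
      refine sum_congr rfl fun e _ => ?_
      rcases h01 (v e) with h | h <;> simp [h]
    rw [tset_eq, hsum, hv]
    simp [LinEqMod.supp]
  · have hsum : (R.toList.map E).sum = lincomb v E := by
      rw [sum_map_toList, lincomb_eq_sum, hR, sum_filter]
      refine sum_congr rfl fun e _ => ?_
      rcases h01 (v e) with h | h <;> simp [h]
    have hb := bz_tbit (E := E) R.toList
    rw [hsum, hv] at hb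
    exact bz_injective (by rw [hb]; rfl)

variable (E)

/-- The line count of one step of the chain. [folklore] -/
def stepHLines (rowL combL : ℕ) : ℕ := rowL + combL + 3 * 1250 + 4

/-- **The carried line along a list of rows**: `⊢ hp a (tset es) D 0 (tbit es), ¬F`, with
`ℓ₀ + |es| · stepHLines` lines — each new row costs its row sequent (`rowHpS`), one root
combination sequent (`combS`) and two cuts; the carried line is used once.
[cite: GalesiEtAl2023, §4] -/
theorem chainHpS (ha : 0 < a) {Dl P D B ℓ₀ rowL : ℕ} (hPh : hsz a Dl ≤ P) (hD : 2 * Dl + 18 ≤ D)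
    (hBc : combB a Dl ≤ B) (hBs : 24 * (P + (PropForm.ofCNF (sumEncoding 1 E)).size) + 100 ≤ B)
    (hrow : ∀ e, BD D B rowL (disjList [hp a (rowSet E e) Dl 0 (rowBit E e),
      neg (PropForm.ofCNF (sumEncoding 1 E))]))
    (h0 : BD D B ℓ₀ (disjList [hp a ∅ Dl 0 false, neg (PropForm.ofCNF (sumEncoding 1 E))])) :
    ∀ es : List (Fin m), BD D B (ℓ₀ + es.length * stepHLines rowL (combLines a Dl))
      (disjList [hp a (tset E es) Dl 0 (tbit E es), neg (PropForm.ofCNF (sumEncoding 1 E))]) := by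
  have hddnF : (neg (PropForm.ofCNF (sumEncoding 1 E))).dd ≤ 4 := dd_neg_ofCNF_le _
  generalize hF : PropForm.ofCNF (sumEncoding 1 E) = F at hddnF hBs hrow h0 ⊢
  have hhp : ∀ (T : Finset ℕ) (c : Bool), (hp a T Dl 0 c).size ≤ P ∧ (hp a T Dl 0 c).dd ≤ 2 * Dl + 2 ∧
      (neg (hp a T Dl 0 c)).dd ≤ 2 * Dl + 4 := fun T c =>
    ⟨(size_hp_le _ _ _ _).trans hPh, dd_hp_le _ _ _ _, by
      rw [dd_neg]; have := altDepthAux_hp_le (a := a) T Dl 0 c 1; omega⟩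
  intro es
  induction es with
  | nil => simpa [tset, tbit] using h0
  | cons e es ih =>
    rw [List.length_cons, Nat.succ_mul, ← Nat.add_assoc]
    have harith : ℓ₀ + es.length * stepHLines rowL (combLines a Dl) + 800 +
        (rowL + 1250 + (combLines a Dl + 1250) + 2) + 2 ≤
        ℓ₀ + es.length * stepHLines rowL (combLines a Dl) + stepHLines rowL (combLines a Dl) := by
      unfold stepHLines; omega
    show BD D B _ (disjList [hp a (symmDiff (tset E es) (rowSet E e)) Dl 0
      (xor (tbit E es) (rowBit E e)), neg F])
    obtain ⟨hT1, hT2, hT3⟩ := hhp (tset E es) (tbit E es)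
    obtain ⟨hR1, hR2, hR3⟩ := hhp (rowSet E e) (rowBit E e)
    obtain ⟨hN1, hN2, hN3⟩ := hhp (symmDiff (tset E es) (rowSet E e)) (xor (tbit E es) (rowBit E e))
    have C := combS ha (tset E es) (rowSet E e) Dl 0 (tbit E es) (rowBit E e) (D := D) (B := B) hD hBc
    rw [comb] at C
    -- align everything to the context `[new, ¬F]`
    have hctx : ∀ X ∈ [neg (hp a (rowSet E e) Dl 0 (rowBit E e)), neg (hp a (tset E es) Dl 0 (tbit E es)),
        hp a (symmDiff (tset E es) (rowSet E e)) Dl 0 (xor (tbit E es) (rowBit E e)), neg F],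
        X.dd ≤ 2 * Dl + 4 := by
      intro X hX
      simp only [List.mem_cons, List.not_mem_nil, or_false] at hX
      rcases hX with rfl | rfl | rfl | rfl
      · exact hR3
      · exact hT3
      · exact hN2.trans (by omega)
      · exact hddnF.trans (by omega)
    have C' : BD D B (combLines a Dl + 1250) (disjList [neg (hp a (rowSet E e) Dl 0 (rowBit E e)),
        neg (hp a (tset E es) Dl 0 (tbit E es)),
        hp a (symmDiff (tset E es) (rowSet E e)) Dl 0 (xor (tbit E es) (rowBit E e)), neg F]) :=
      subsetN (N := 4) C (by
          intro X hX; simp only [List.mem_cons, List.not_mem_nil, or_false] at hX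
          rcases hX with rfl | rfl | rfl
          exacts [List.mem_cons_of_mem _ List.mem_cons_self, List.mem_cons_self, List.mem_cons_of_mem _ (List.mem_cons_of_mem _ List.mem_cons_self)])
        hctx (by omega) (by
          simp only [size_disjList_cons, size_disjList_nil, size]; omega) (by simp) (by simp)
    have R' : BD D B (rowL + 1250) (disjList [hp a (rowSet E e) Dl 0 (rowBit E e),
        neg (hp a (tset E es) Dl 0 (tbit E es)),
        hp a (symmDiff (tset E es) (rowSet E e)) Dl 0 (xor (tbit E es) (rowBit E e)), neg F]) :=
      subsetN (N := 4) (hrow e) (by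
          intro X hX; simp only [List.mem_cons, List.not_mem_nil, or_false] at hX
          rcases hX with rfl | rfl
          exacts [List.mem_cons_self, List.mem_cons_of_mem _ (List.mem_cons_of_mem _ (List.mem_cons_of_mem _ List.mem_cons_self))])
        (p := 2 * Dl + 4) (by
          intro X hX; simp only [List.mem_cons, List.not_mem_nil, or_false] at hX
          rcases hX with rfl | rfl | rfl | rfl
          · exact hR2.trans (by omega)
          · exact hT3
          · exact hN2.trans (by omega)
          · exact hddnF.trans (by omega)) (by omega) (by
          simp only [size_disjList_cons, size_disjList_nil, size]; omega) (by simp) (by simp)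
    have c1 := cutS R' C' (by simp only [size_disjList_cons, size_disjList_nil, size]; omega)
    have J' : BD D B (ℓ₀ + es.length * stepHLines rowL (combLines a Dl) + 800)
        (disjList [hp a (tset E es) Dl 0 (tbit E es),
          hp a (symmDiff (tset E es) (rowSet E e)) Dl 0 (xor (tbit E es) (rowBit E e)), neg F]) :=
      subsetN (N := 3) ih (by
          intro X hX; simp only [List.mem_cons, List.not_mem_nil, or_false] at hX
          rcases hX with rfl | rfl
          exacts [List.mem_cons_self, List.mem_cons_of_mem _ (List.mem_cons_of_mem _ List.mem_cons_self)])
        (p := 2 * Dl + 4) (by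
          intro X hX; simp only [List.mem_cons, List.not_mem_nil, or_false] at hX
          rcases hX with rfl | rfl | rfl
          · exact hT2.trans (by omega)
          · exact hN2.trans (by omega)
          · exact hddnF.trans (by omega)) (by omega) (by
          simp only [size_disjList_cons, size_disjList_nil, size]; omega) (by simp) (by simp)
    have c2 := cutS J' c1 (by simp only [size_disjList_cons, size_disjList_nil, size]; omega)
    exact c2.mono harith

/-- The total line count of the refutation. [folklore] -/
def totHLines (m rowL combL endL : ℕ) : ℕ :=
  endL + 450 + m * stepHLines rowL combL + (endL + 450) + 2 + 8

/-- **A bounded refutation of an unsatisfiable system, at depth `2D + 18`.** From unsatisfiability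
(a dual certificate), the chain starts at `⊢ hp a ∅ D 0 false, ¬F` (`startS`), runs along the
certificate, ends at `⊢ hp a ∅ D 0 true, ¬F`, and `endS` cuts the parity formula away: `¬F`.
[cite: GalesiEtAl2023, §4] -/
theorem refuteHpS (ha : 0 < a) {Dl P D B rowL : ℕ} (hPh : hsz a Dl ≤ P) (hD : 2 * Dl + 18 ≤ D)
    (hBc : combB a Dl ≤ B) (hBs : 24 * (P + (PropForm.ofCNF (sumEncoding 1 E)).size) + 100 ≤ B)
    (hBe : 40 * (hsz a Dl + 2) + 200 ≤ B)
    (hrow : ∀ e, BD D B rowL (disjList [hp a (rowSet E e) Dl 0 (rowBit E e),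
      neg (PropForm.ofCNF (sumEncoding 1 E))]))
    (hunsat : ¬ SystemSat E univ) :
    BD D B (totHLines m rowL (combLines a Dl) (endLines (hsz a Dl)))
      (neg (PropForm.ofCNF (sumEncoding 1 E))) := by
  have hddnF : (neg (PropForm.ofCNF (sumEncoding 1 E))).dd ≤ 4 := dd_neg_ofCNF_le _
  obtain ⟨es, hlen, hT, hb⟩ := exists_certificate hunsat
  have hF1 := altDepthAux_le_dd_succ 1 (neg (PropForm.ofCNF (sumEncoding 1 E)))
  have hsz0 := size_hp_le (a := a) ∅ Dl 0 false
  have hsz1 := size_hp_le (a := a) ∅ Dl 0 true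
  have hdd0 := dd_hp_le (a := a) ∅ Dl 0 false
  have hdd1 : (neg (hp a ∅ Dl 0 true)).dd ≤ 2 * Dl + 4 := by
    rw [dd_neg]; have := altDepthAux_hp_le (a := a) ∅ Dl 0 true 1; omega
  -- start
  have s := startS ha Dl 0 (D := D) (B := B) (by omega) hBe
  have s' : BD D B (endLines (hsz a Dl) + 450)
      (disjList [hp a ∅ Dl 0 false, neg (PropForm.ofCNF (sumEncoding 1 E))]) :=
    subsetN (N := 2) s (by
        intro X hX; rw [List.mem_singleton] at hX; rw [hX]; exact List.mem_cons_self)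
      (p := 2 * Dl + 4) (by
        intro X hX; simp only [List.mem_cons, List.not_mem_nil, or_false] at hX
        rcases hX with rfl | rfl
        · exact hdd0.trans (by omega)
        · exact hddnF.trans (by omega)) (by omega) (by
        simp only [size_disjList_cons, size_disjList_nil, size]; omega) (by simp) (by simp)
  -- the chain, at the certificate
  have J := chainHpS E ha hPh hD hBc hBs hrow s' es
  rw [hT, hb] at J
  have J' : BD D B (endLines (hsz a Dl) + 450 + m * stepHLines rowL (combLines a Dl))
      (disjList [hp a ∅ Dl 0 true, neg (PropForm.ofCNF (sumEncoding 1 E))]) :=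
    J.mono (by have := Nat.mul_le_mul_right (stepHLines rowL (combLines a Dl)) hlen; omega)
  -- end
  have t := endS ha Dl 0 (D := D) (B := B) (by omega) hBe
  have t' : BD D B (endLines (hsz a Dl) + 450)
      (disjList [neg (hp a ∅ Dl 0 true), neg (PropForm.ofCNF (sumEncoding 1 E))]) :=
    subsetN (N := 2) t (by
        intro X hX; rw [List.mem_singleton] at hX; rw [hX]; exact List.mem_cons_self)
      (p := 2 * Dl + 4) (by
        intro X hX; simp only [List.mem_cons, List.not_mem_nil, or_false] at hX
        rcases hX with rfl | rfl
        · exact hdd1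
        · exact hddnF.trans (by omega)) (by omega) (by
        simp only [size_disjList_cons, size_disjList_nil, size]; omega) (by simp) (by simp)
  have c := cutS J' t' (by simp only [size_disjList_cons, size_disjList_nil, size]; omega)
  have c' : BD D B (endLines (hsz a Dl) + 450 + m * stepHLines rowL (combLines a Dl) +
      (endLines (hsz a Dl) + 450) + 2)
      (disj (neg (PropForm.ofCNF (sumEncoding 1 E))) (const false)) := c
  have fin := removeBotB c' (by rw [dd_neg]; omega) (by simp only [size]; omega)
  exact fin

end Chain

end HierParity

end Literature.Computability.MetaComplexity
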